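import Mathlib.NumberTheory.LSeries.RiemannZeta
import Literature.NumberTheory.LFunctions.ZetaFractionalPartIntegral
import HarnessLib

/-!
# `ζ(σ) < 0` for real `0 < σ < 1`: no real zeros of `ζ` in the critical strip (Titchmarsh §2.12)

Trunk T-ANT (NumberTheory/LFunctions). Companion to
`Literature/NumberTheory/LFunctions/ZetaFractionalPartIntegral.lean`, which proves Titchmarsh's
formula (2.1.4), `ζ(s) = s/(s-1) - s ∫_1^∞ {x} x^{-s-1} dx` on `Re s > 0`, `s ≠ 1`
(`Literature.NumberTheory.LFunctions.riemannZeta_eq_of_re_pos`). Restricting (2.1.4) to the real axis: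

* the fractional-part integral `∫_1^∞ {x} x^{-σ-1} dx` is a real number `≥ 0` for real `σ`
  (`Literature.NumberTheory.LFunctions.fractIntegral_ofReal`, `Literature.NumberTheory.LFunctions.fractIntegralReal_nonneg`);
* hence `ζ(σ)` is real for `σ > 0`, `σ ≠ 1` (`Literature.NumberTheory.LFunctions.riemannZeta_im_eq_zero_of_pos`, extending
  Mathlib's `riemannZeta_im_eq_zero_of_one_lt`), and for `0 < σ < 1`,
  `ζ(σ) = σ/(σ-1) - σ ∫_1^∞ {x} x^{-σ-1} dx ≤ σ/(σ-1) < 0` (`Literature.NumberTheory.LFunctions.riemannZeta_neg_of_pos_of_lt_one`,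
  in `ComplexOrder`, the counterpart of Mathlib's `riemannZeta_pos_of_one_lt`);
* so `ζ(σ) ≠ 0` for `0 ≤ σ < 1` (`ζ(0) = -1/2`, Mathlib `riemannZeta_zero`):
  `Literature.NumberTheory.LFunctions.riemannZeta_ofReal_ne_zero_of_nonneg_of_lt_one`, and in complex form
  `Literature.NumberTheory.LFunctions.riemannZeta_ne_zero_of_im_eq_zero_of_pos_of_lt_one`
  (`Im s = 0`, `0 < Re s < 1 ⟹ ζ(s) ≠ 0`): the zeros of
  `ζ` in the critical strip are all non-real.

This is Titchmarsh, *The Theory of the Riemann Zeta-Function* (2nd ed., 1986), §2.12, the text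
following (2.12.4): "ζ(s) has no zeros on the real axis between 0 and 1. The zeros
ρ₁, ρ₂, … are therefore all complex", where the sign is read off the alternating series (2.12.4),
`(1 - 2^{1-s}) ζ(s) = 1 - 2^{-s} + 3^{-s} - ⋯ > 0` (`0 < s < 1`). Reading it off (2.1.4) instead
(same section §2.1 of the source) avoids conditionally convergent Dirichlet series, which
Mathlib's `tsum` does not express; the conclusion `ζ(σ) < 0` on `(0, 1)` is the same.

All results are proved (no named facts). The named fact `Literature.NumberTheory.LFunctions.riemannZeta_ne_zero_of_mem_Ioo`
of `Literature/NumberTheory/LFunctions/LevinsonMontgomery.lean` is, verbatim,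
`riemannZeta_ofReal_ne_zero_of_pos_of_lt_one` below.

## References

* E. C. Titchmarsh, *The Theory of the Riemann Zeta-Function*, 2nd ed. (rev. D. R. Heath-Brown),
  Oxford 1986, §2.1 eq. (2.1.4); §2.12, text after eq. (2.12.4).
-/

noncomputable section

open Complex Set MeasureTheory
open scoped ComplexOrder

namespace Literature.NumberTheory.LFunctions

/-! ### The fractional-part integral on the real axis -/

/-- The real fractional-part integral `∫_1^∞ {x} x^{-(σ+1)} dx` is non-negative (integrand `≥ 0`).
[folklore] -/
theorem fractIntegralReal_nonneg (σ : ℝ) :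
    0 ≤ ∫ x in Ioi (1 : ℝ), Int.fract x * x ^ (-(σ + 1)) :=
  setIntegral_nonneg measurableSet_Ioi fun x hx ↦
    mul_nonneg (Int.fract_nonneg x) (Real.rpow_nonneg (zero_le_one.trans (le_of_lt hx)) _)

/-- On the real axis `fractIntegral` is the real integral `∫_1^∞ {x} x^{-(σ+1)} dx` (cast to `ℂ`).
[folklore] -/
theorem fractIntegral_ofReal (σ : ℝ) :
    fractIntegral σ = ((∫ x in Ioi (1 : ℝ), Int.fract x * x ^ (-(σ + 1)) : ℝ) : ℂ) := by
  rw [fractIntegral_def, ← integral_complex_ofReal]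
  refine setIntegral_congr_fun measurableSet_Ioi fun x hx ↦ ?_
  have hx0 : 0 ≤ x := zero_le_one.trans (le_of_lt hx)
  push_cast
  rw [Complex.ofReal_cpow hx0]
  push_cast
  rfl

/-- `fractIntegral σ` is a non-negative real for real `σ`: `0 ≤ Re`, `Im = 0`. [folklore] -/
theorem fractIntegral_ofReal_re_nonneg (σ : ℝ) :
    0 ≤ (fractIntegral σ).re ∧ (fractIntegral σ).im = 0 := by
  rw [fractIntegral_ofReal, ofReal_re, ofReal_im]
  exact ⟨fractIntegralReal_nonneg σ, rfl⟩

/-! ### `ζ` on the real half-line `σ > 0` -/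

/-- **Titchmarsh (2.1.4) on the real axis.** For real `σ > 0`, `σ ≠ 1`:
`ζ(σ) = σ/(σ-1) - σ ∫_1^∞ {x} x^{-(σ+1)} dx`, a real number. [cite: Titchmarsh1986, §2.1 eq. (2.1.4)] -/
theorem riemannZeta_ofReal_eq_of_pos {σ : ℝ} (h0 : 0 < σ) (h1 : σ ≠ 1) :
    riemannZeta σ =
      ((σ / (σ - 1) - σ * ∫ x in Ioi (1 : ℝ), Int.fract x * x ^ (-(σ + 1)) : ℝ) : ℂ) := by
  have hs : 0 < (σ : ℂ).re := by simpa using h0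
  have hs1 : (σ : ℂ) ≠ 1 := by exact_mod_cast h1
  rw [riemannZeta_eq_of_re_pos hs hs1, fractIntegral_ofReal]
  push_cast
  ring

/-- `ζ(σ)` is real for real `σ > 0`, `σ ≠ 1` (Titchmarsh §2.12: "ζ(s) is real on the real axis";
Mathlib has the case `σ > 1`, `riemannZeta_im_eq_zero_of_one_lt`). [cite: Titchmarsh1986, §2.12] -/
theorem riemannZeta_im_eq_zero_of_pos {σ : ℝ} (h0 : 0 < σ) (h1 : σ ≠ 1) :
    (riemannZeta σ).im = 0 := by
  rw [riemannZeta_ofReal_eq_of_pos h0 h1, ofReal_im]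

/-- For real `0 < σ < 1`, `Re ζ(σ) ≤ σ/(σ-1)` (drop the non-negative integral in (2.1.4)); in
particular `Re ζ(σ) < 0`. [cite: Titchmarsh1986, §2.1 eq. (2.1.4)] -/
theorem riemannZeta_ofReal_re_le_of_pos_of_lt_one {σ : ℝ} (h0 : 0 < σ) (h1 : σ < 1) :
    (riemannZeta σ).re ≤ σ / (σ - 1) := by
  rw [riemannZeta_ofReal_eq_of_pos h0 h1.ne, ofReal_re]
  have hI := fractIntegralReal_nonneg σ
  nlinarith

/-- **`ζ(σ) < 0` for real `0 < σ < 1`** (in `ComplexOrder`: `Re ζ(σ) < 0` and `Im ζ(σ) = 0`), the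
counterpart on `(0, 1)` of Mathlib's `riemannZeta_pos_of_one_lt`. From (2.1.4):
`ζ(σ) ≤ σ/(σ-1) < 0`. Titchmarsh §2.12 obtains the sign from (2.12.4),
`(1 - 2^{1-s}) ζ(s) = 1 - 2^{-s} + 3^{-s} - ⋯ > 0` for `0 < s < 1`.
[cite: Titchmarsh1986, §2.12 (text after (2.12.4)); §2.1 (2.1.4)] -/
theorem riemannZeta_neg_of_pos_of_lt_one {σ : ℝ} (h0 : 0 < σ) (h1 : σ < 1) : riemannZeta σ < 0 := by
  rw [Complex.neg_iff]
  refine ⟨(riemannZeta_ofReal_re_le_of_pos_of_lt_one h0 h1).trans_lt ?_,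
    riemannZeta_im_eq_zero_of_pos h0 h1.ne⟩
  exact div_neg_of_pos_of_neg h0 (by linarith)

/-- `Re ζ(σ) < 0` for real `0 < σ < 1`. [cite: Titchmarsh1986, §2.12 (text after (2.12.4))] -/
theorem riemannZeta_re_neg_of_pos_of_lt_one {σ : ℝ} (h0 : 0 < σ) (h1 : σ < 1) :
    (riemannZeta σ).re < 0 :=
  (Complex.neg_iff.mp (riemannZeta_neg_of_pos_of_lt_one h0 h1)).1

/-! ### No real zeros in the critical strip -/

/-- `ζ(σ) ≠ 0` for real `0 < σ < 1`: "ζ(s) has no zeros on the real axis between 0 and 1"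
(Titchmarsh §2.12). This is, verbatim, the statement of the named fact
`Literature.NumberTheory.LFunctions.riemannZeta_ne_zero_of_mem_Ioo` (`LevinsonMontgomery.lean`).
[cite: Titchmarsh1986, §2.12 (text after (2.12.4))] -/
theorem riemannZeta_ofReal_ne_zero_of_pos_of_lt_one (σ : ℝ) (h0 : 0 < σ) (h1 : σ < 1) :
    riemannZeta σ ≠ 0 := fun h ↦ by
  have := riemannZeta_re_neg_of_pos_of_lt_one h0 h1
  rw [h, zero_re] at this
  exact lt_irrefl _ this

/-- `ζ(σ) ≠ 0` for real `0 ≤ σ < 1` (adds `ζ(0) = -1/2 ≠ 0`, Mathlib `riemannZeta_zero`; Titchmarsh: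
"and ζ(0) ≠ 0"). [cite: Titchmarsh1986, §2.12 (text after (2.12.4))] -/
theorem riemannZeta_ofReal_ne_zero_of_nonneg_of_lt_one {σ : ℝ} (h0 : 0 ≤ σ) (h1 : σ < 1) :
    riemannZeta σ ≠ 0 := by
  rcases h0.eq_or_lt with rfl | h0
  · rw [ofReal_zero, riemannZeta_zero]; norm_num
  · exact riemannZeta_ofReal_ne_zero_of_pos_of_lt_one σ h0 h1

/-- Complex form: a real point `s` (`Im s = 0`) of the open critical strip `0 < Re s < 1` is not a
zero of `ζ`; equivalently, every zero of `ζ` in the critical strip is non-real ("The zeros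
ρ₁, ρ₂, … are therefore all complex", Titchmarsh §2.12).
[cite: Titchmarsh1986, §2.12 (text after (2.12.4))] -/
theorem riemannZeta_ne_zero_of_im_eq_zero_of_pos_of_lt_one {s : ℂ} (him : s.im = 0) (h0 : 0 < s.re)
    (h1 : s.re < 1) : riemannZeta s ≠ 0 := by
  have hs : s = (s.re : ℂ) := Complex.ext (by simp) (by simp [him])
  rw [hs]
  exact riemannZeta_ofReal_ne_zero_of_pos_of_lt_one s.re h0 h1

/-- Contrapositive: a zero of `ζ` in the open critical strip has `Im s ≠ 0`.
[cite: Titchmarsh1986, §2.12 (text after (2.12.4))] -/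
theorem im_ne_zero_of_riemannZeta_eq_zero {s : ℂ} (hs : riemannZeta s = 0) (h0 : 0 < s.re)
    (h1 : s.re < 1) : s.im ≠ 0 :=
  fun him ↦ riemannZeta_ne_zero_of_im_eq_zero_of_pos_of_lt_one him h0 h1 hs

end Literature.NumberTheory.LFunctions

end
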